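import Summits.QuantumFields.YangMills.Theorems.PoincareLipschitzIteratedOfAvgStabilityModGauge
import HarnessLib

/-!
# Crux stmt-QuantumFields-19936 `HistoryTailL`, line `poincare_lipschitz`, route crux `BlockLipschitzL` (stmt-QuantumFields-23533):
# the K2-TOP door RESTRICTED TO THE PERTURBATIVE REGIME — suppliers of «average stability modulo gauge» may assume the pair is
# `ℓ²`-CLOSE, `‖U − U'‖_{ℓ²(box)} ≤ T·√(L^{j+1})·θ(K−j)`; far pairs are settled here by [Balaban1985Averaging] Prop. 1 in local form

WHY.  Both fields of a hierarchically small pair have their height-`(j+1)` averaged plaquette variable ALREADY small: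
`dist1(Ū^{j+1}(∂a)) < 151·L²·θ(K−j)` (✓`BlockAveragingPlaquetteBoundLocal.dist1_plaqHol_avgFun_lt_of_near` = [Balaban1985Averaging] Prop. 1 local,
read at height `j` through this lane's level-generic window bookkeeping ✓`tdist_add_le_of_near_level`) — `dist1_plaqHol_iter_succ_lt_of_windows`.  Hence
`|dist1(Ū^{j+1}(∂a))(U) − dist1(Ū^{j+1}(∂a))(U')| < 302·L²·θ(K−j)` for EVERY good pair (`abs_dist1_iter_succ_sub_lt_of_windows`), and the Lipschitz
bound of `stub_iteratedLipschitz` is automatic for pairs with `‖U − U'‖_{ℓ²(box)} > T·√(L^{j+1})·θ(K−j)` (constant `302·L²/T`).  So the displayed row of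
the K2-TOP door ✓`stub_iteratedLipschitz_of_avgStabilityModGauge` (p679967) need only be supplied on the complementary PERTURBATIVE REGIME — the
regime in which the orbit-minimised perturbation has small walk masses at every height and [Balaban1985Averaging] Props 3–5 apply (card v1.26 (R4)).

THIS FILE: `stub_iteratedLipschitz_of_avgStabilityModGauge_near` — `stub_iteratedLipschitz` VERBATIM from the row «for each `L` there are `T > 0`
and `CS ≥ 0` such that … (windows) … `√(box sum) ≤ T·√(L^{j+1})·θBal(K−j)` → ∃ h, footprint bound with `CS/√(L^{j+1})`», with
`CL := max(484·L·CS, 302·L²/T)`.  Composes with ★w5 g10's orbit-minimiser door (✓p681042) on the supplier side (both restrictions may be imposed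
at once by the supplier: minimise first, the box distance only decreases).

WHAT THIS IS NOT: the restricted row is NOT proved; nothing here proves `BlockLipschitzL`, `HistoryTailL`, rung R3 (YM₃ on T³ — not d = 4, not
infinite volume, not a mass gap, not the Clay problem) or a summit statement.  LEAD seat ym-ust-19936-w1 g7 (cell ym3-torus).
-/

noncomputable section

open scoped BigOperators Matrix.Norms.L2Operator

namespace Summit.QuantumFields.YangMills.Theorems.PoincareLipschitzIteratedOfAvgStabilityNear

open Literature.MathematicalPhysics.QuantumFieldTheory.Balaban1983to89
open Literature.MathematicalPhysics.QuantumFieldTheory.Balaban1983to89.T3ContinuumYM3Torus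
open Literature.MathematicalPhysics.QuantumFieldTheory.Balaban1983to89.T3UnitLawDensityEML
open T4Continuum BlockAveraging AveragingRT ExpMeanLog T3UnitScaleTilt
open Summit.QuantumFields.YangMills.Theorems.PoincareLipschitzLevelOneLipschitz (near_of_edge_block sixth_le_half_deltaSU_two)
open Summit.QuantumFields.YangMills.Theorems.PoincareLipschitzIteratedOfAvgStability
  (tdist_add_le_of_near_level abs_dist1_iter_succ_sub_le_of_gaugeCopy)

/-! ## §1 A hierarchically small field has a small averaged plaquette variable one height up -/

section Absolute

variable {F : T3Family} {K j : ℕ} {γ b₀ p₀ : ℝ}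

/-- **SMALLNESS ONE HEIGHT UP** ([Balaban1985Averaging] Prop. 1, local form, at height `j`): if the height-`j` averaged plaquette variables of `U` in
the blocks at `ℓ^∞`-distance `≤ 1` from the corner of the level-`(j+1)` plaquette `a` are below `θ(K−j) ≤ 1/(75(L+1)²)` (the crux's window at
height `j` gives this, `j + 3 ≤ K`), then `dist1(Ū^{j+1}(U)(∂a)) < 151·L²·θ(K−j)`. [cite: Balaban1985Averaging, Prop. 1 (51) p.26; Balaban1987RG1, (0.4) p.253] -/
theorem dist1_plaqHol_iter_succ_lt_of_windows (hjK : j + 3 ≤ K) (hγ : 0 < γ) (hγ1 : γ ≤ 1) (hb : 0 < b₀)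
    (hθσ : θBal F.L γ b₀ p₀ (K - j) ≤ 1 / (75 * ((F.L : ℝ) + 1) ^ 2))
    (a : Plaq (F.P K) (j + 1)) (U : GaugeField (F.P K) 0 (Matrix.specialUnitaryGroup (Fin 2) ℂ))
    (hU : (∀ (i : ℕ) (q : Plaq (F.P K) i), i < j + 1 → Site.tdist (fun k => ((((q.src k).val * F.L ^ i : ℕ)) : ZMod ((F.P K).sitesPerDir 0))) (fun k => ((((a.src k).val * F.L ^ (j + 1) : ℕ)) : ZMod ((F.P K).sitesPerDir 0))) + 64 * F.L ^ i ≤ 64 * F.L ^ (j + 1) → GaugeGroup.dist1 (GaugeField.plaqHol (Averaging.iter (fun i' => BlockAveraging.blockAvg (P := F.P K) (j := i') T3UnitLawDensityEML.ℰp) i U) q) < T3UnitScaleTilt.θBal F.L γ b₀ p₀ (K - i))) :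
    GaugeGroup.dist1 (GaugeField.plaqHol (Averaging.iter (fun i' => BlockAveraging.blockAvg (P := F.P K) (j := i') T3UnitLawDensityEML.ℰp) (j + 1) U) a) < 151 * (F.L : ℝ) ^ 2 * θBal F.L γ b₀ p₀ (K - j) := by
  have hL3 : 3 ≤ F.L := (by obtain ⟨k, hk⟩ := F.hL.1; have := F.hL.2; omega)
  have hjr : j + 1 ≤ (F.P K).m + (F.P K).K := by
    show j + 1 ≤ F.m + K
    have := F.hm; omega
  have hθ0 : 0 ≤ θBal F.L γ b₀ p₀ (K - j) := (T3MinimiserStabilityReduction.θBal_pos (by omega) hγ hγ1 hb p₀ (K - j)).le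
  -- the strict guard `((d+2)L)²/4 · θ < δ_2`
  have e5 : ((((F.P K).d + 2) * (F.P K).L : ℕ) : ℝ) = 5 * F.L := by
    show ((((3 + 2) * F.L : ℕ)) : ℝ) = 5 * F.L
    push_cast; ring
  have ht : ((((F.P K).d + 2) * (F.P K).L : ℕ) : ℝ) ^ 2 / 4 * θBal F.L γ b₀ p₀ (K - j) < deltaSU (Fin 2) := by
    rw [e5]
    have h1 : (5 * (F.L : ℝ)) ^ 2 / 4 * (1 / (75 * ((F.L : ℝ) + 1) ^ 2)) = (F.L : ℝ) ^ 2 / (12 * ((F.L : ℝ) + 1) ^ 2) := by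
      field_simp; ring
    have h2 : (F.L : ℝ) ^ 2 / (12 * ((F.L : ℝ) + 1) ^ 2) < 1 / 6 := by
      rw [div_lt_div_iff₀ (by positivity) (by norm_num)]
      nlinarith
    have h3 : (1 : ℝ) / 6 < deltaSU (Fin 2) := by
      have := sixth_le_half_deltaSU_two
      have hδ : 0 < deltaSU (Fin 2) := deltaSU_pos
      linarith
    calc (5 * (F.L : ℝ)) ^ 2 / 4 * θBal F.L γ b₀ p₀ (K - j) ≤ (5 * (F.L : ℝ)) ^ 2 / 4 * (1 / (75 * ((F.L : ℝ) + 1) ^ 2)) :=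
          mul_le_mul_of_nonneg_left hθσ (by positivity)
      _ < 1 / 6 := by rw [h1]; exact h2
      _ < deltaSU (Fin 2) := h3
  -- the window at height `j`, read on the blocks at `ℓ^∞`-distance ≤ 1 from `a.src`
  have hnear : ∀ q : Plaq (F.P K) j, (∀ κ, blockOf q.src κ = a.src κ ∨ blockOf q.src κ = a.src κ + 1 ∨ blockOf q.src κ = a.src κ - 1) →
      dist1 (GaugeField.plaqHol (Averaging.iter (fun i' => BlockAveraging.blockAvg (P := F.P K) (j := i') T3UnitLawDensityEML.ℰp) j U) q) < θBal F.L γ b₀ p₀ (K - j) := by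
    intro q hq
    have hq' : ∀ κ, blockOf q.src κ = a.src κ ∨ blockOf q.src κ = a.src κ + 1 ∨ blockOf q.src κ = a.src κ - 1 ∨
        blockOf q.src κ = a.src κ + 2 := fun κ => by rcases hq κ with h | h | h <;> simp [h]
    exact hU j q (Nat.lt_succ_self j) (tdist_add_le_of_near_level hjK a.src q.src hq')
  have hiU : Averaging.iter (fun i' => BlockAveraging.blockAvg (P := F.P K) (j := i') T3UnitLawDensityEML.ℰp) (j + 1) U = avgFun ℰp (Averaging.iter (fun i' => BlockAveraging.blockAvg (P := F.P K) (j := i') T3UnitLawDensityEML.ℰp) j U) := rfl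
  rw [hiU]
  have key := BlockAveragingPlaquetteBoundLocal.dist1_plaqHol_avgFun_lt_of_near (n := Fin 2) hjr hθ0 a hnear ht
  refine key.trans_le (le_of_eq ?_)
  have ePL : ((F.P K).L : ℝ) = F.L := rfl
  rw [e5, ePL]
  ring

/-- **TWO GOOD FIELDS HAVE THEIR HEIGHT-`(j+1)` AVERAGED PLAQUETTE DEVIATIONS WITHIN `302·L²·θ(K−j)`** (each is `< 151·L²·θ(K−j)` and `≥ 0`).
[cite: Balaban1985Averaging, Prop. 1 (51) p.26] -/
theorem abs_dist1_iter_succ_sub_lt_of_windows (hjK : j + 3 ≤ K) (hγ : 0 < γ) (hγ1 : γ ≤ 1) (hb : 0 < b₀)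
    (hθσ : θBal F.L γ b₀ p₀ (K - j) ≤ 1 / (75 * ((F.L : ℝ) + 1) ^ 2))
    (a : Plaq (F.P K) (j + 1)) (U U' : GaugeField (F.P K) 0 (Matrix.specialUnitaryGroup (Fin 2) ℂ))
    (hU : (∀ (i : ℕ) (q : Plaq (F.P K) i), i < j + 1 → Site.tdist (fun k => ((((q.src k).val * F.L ^ i : ℕ)) : ZMod ((F.P K).sitesPerDir 0))) (fun k => ((((a.src k).val * F.L ^ (j + 1) : ℕ)) : ZMod ((F.P K).sitesPerDir 0))) + 64 * F.L ^ i ≤ 64 * F.L ^ (j + 1) → GaugeGroup.dist1 (GaugeField.plaqHol (Averaging.iter (fun i' => BlockAveraging.blockAvg (P := F.P K) (j := i') T3UnitLawDensityEML.ℰp) i U) q) < T3UnitScaleTilt.θBal F.L γ b₀ p₀ (K - i)))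
    (hU' : (∀ (i : ℕ) (q : Plaq (F.P K) i), i < j + 1 → Site.tdist (fun k => ((((q.src k).val * F.L ^ i : ℕ)) : ZMod ((F.P K).sitesPerDir 0))) (fun k => ((((a.src k).val * F.L ^ (j + 1) : ℕ)) : ZMod ((F.P K).sitesPerDir 0))) + 64 * F.L ^ i ≤ 64 * F.L ^ (j + 1) → GaugeGroup.dist1 (GaugeField.plaqHol (Averaging.iter (fun i' => BlockAveraging.blockAvg (P := F.P K) (j := i') T3UnitLawDensityEML.ℰp) i U') q) < T3UnitScaleTilt.θBal F.L γ b₀ p₀ (K - i))) :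
    |GaugeGroup.dist1 (GaugeField.plaqHol (Averaging.iter (fun i' => BlockAveraging.blockAvg (P := F.P K) (j := i') T3UnitLawDensityEML.ℰp) (j + 1) U) a) -
        GaugeGroup.dist1 (GaugeField.plaqHol (Averaging.iter (fun i' => BlockAveraging.blockAvg (P := F.P K) (j := i') T3UnitLawDensityEML.ℰp) (j + 1) U') a)| < 302 * (F.L : ℝ) ^ 2 * θBal F.L γ b₀ p₀ (K - j) := by
  have h1 := dist1_plaqHol_iter_succ_lt_of_windows hjK hγ hγ1 hb hθσ a U hU
  have h2 := dist1_plaqHol_iter_succ_lt_of_windows hjK hγ hγ1 hb hθσ a U' hU'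
  have h1' := GaugeGroup.dist1_nonneg (GaugeField.plaqHol (Averaging.iter (fun i' => BlockAveraging.blockAvg (P := F.P K) (j := i') T3UnitLawDensityEML.ℰp) (j + 1) U) a)
  have h2' := GaugeGroup.dist1_nonneg (GaugeField.plaqHol (Averaging.iter (fun i' => BlockAveraging.blockAvg (P := F.P K) (j := i') T3UnitLawDensityEML.ℰp) (j + 1) U') a)
  rw [abs_lt]
  constructor <;> linarith

end Absolute

/-! ## §2 The door restricted to the perturbative regime -/

section Door

/-- ★ **`stub_iteratedLipschitz` ⟸ AVERAGE STABILITY MODULO GAUGE ON `ℓ²`-CLOSE PAIRS.**  If for each `L` there are `T > 0` and `CS ≥ 0` such that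
(for all thresholds, a `γ₁`, all families with `F.L = L`, all `1 ≤ j`, `j + 3 ≤ K`, every level-`(j+1)` plaquette `a`, every hierarchically small
pair `U, U'` whose box `ℓ²` link distance is AT MOST `T·√(L^{j+1})·θBal(K−j)`) some level-`j` gauge copy of `Ū^j(U')` is within
`CS/√(L^{j+1})·(box distance)` of `Ū^j(U)` in `dist1` on the footprints of `∂a`, then the registered stub `stub_iteratedLipschitz` holds VERBATIM with
`CL := max(484·L·CS, 302·L²/T)`: close pairs through the K2-TOP step ✓`abs_dist1_iter_succ_sub_le_of_gaugeCopy`, far pairs through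
`abs_dist1_iter_succ_sub_lt_of_windows`. [cite: Balaban1987RG1, (0.4) p.253; Balaban1985Averaging, Prop. 1 (51) p.26, (11) p.19] -/
theorem stub_iteratedLipschitz_of_avgStabilityModGauge_near
    (hStab : open Literature.MathematicalPhysics.QuantumFieldTheory.Balaban1983to89 Literature.MathematicalPhysics.QuantumFieldTheory.Balaban1983to89.T3ContinuumYM3Torus in ∀ (L : ℕ), ∃ T : ℝ, 0 < T ∧ ∃ CS : ℝ, 0 ≤ CS ∧ ∀ (b₀ p₀ : ℝ), 0 < b₀ → 2 < p₀ → ∃ γ₁ : ℝ, 0 < γ₁ ∧ γ₁ ≤ 1 ∧ ∀ (F : T3Family) (γ : ℝ), F.L = L → 0 < γ → γ ≤ γ₁ → ∀ (K j : ℕ), 1 ≤ j → j + 3 ≤ K → ∀ (a : Plaq (F.P K) (j + 1)) (U U' : GaugeField (F.P K) 0 (Matrix.specialUnitaryGroup (Fin 2) ℂ)), (∀ (i : ℕ) (q : Plaq (F.P K) i), i < j + 1 → Site.tdist (fun k => ((((q.src k).val * F.L ^ i : ℕ)) : ZMod ((F.P K).sitesPerDir 0))) (fun k => ((((a.src k).val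 * F.L ^ (j + 1) : ℕ)) : ZMod ((F.P K).sitesPerDir 0))) + 64 * F.L ^ i ≤ 64 * F.L ^ (j + 1) → GaugeGroup.dist1 (GaugeField.plaqHol (Averaging.iter (fun i' => BlockAveraging.blockAvg (P := F.P K) (j := i') T3UnitLawDensityEML.ℰp) i U) q) < T3UnitScaleTilt.θBal F.L γ b₀ p₀ (K - i)) → (∀ (i : ℕ) (q : Plaq (F.P K) i), i < j + 1 → Site.tdist (fun k => ((((q.src k).val * F.L ^ i : ℕ)) : ZMod ((F.P K).sitesPerDir 0))) (fun k => ((((a.src k).val * F.L ^ (j + 1) : ℕ)) : ZMod ((F.P K).sitesPerDir 0))) + 64 * F.L ^ i ≤ 64 * F.L ^ (j + 1) → GaugeGroup.dist1 (GaugeField.plaqHol (Averaging.iter (fun i' => BlockAveraging.blockAvg (P := F.P K) (j := i') T3UnitLawDensityEML.ℰp) i U') q) < T3UnitScaleTilt.θBal F.L γ b₀ p₀ (K - i)) → Real.sqrt (∑ b : PBond (F.P K) 0, if (∀ k, (b.src k - ((((a.src k).val * F.L ^ (j + 1) : ℕ)) : ZMod ((F.P K).sitesPerDir 0)) + ((8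 * F.L ^ (j + 1) : ℕ) : ZMod ((F.P K).sitesPerDir 0))).val < 17 * F.L ^ (j + 1)) ∧ (∀ k, (b.tgt k - ((((a.src k).val * F.L ^ (j + 1) : ℕ)) : ZMod ((F.P K).sitesPerDir 0)) + ((8 * F.L ^ (j + 1) : ℕ) : ZMod ((F.P K).sitesPerDir 0))).val < 17 * F.L ^ (j + 1)) then GaugeGroup.dist1 (U b * (U' b)⁻¹) ^ 2 else 0) ≤ T * Real.sqrt ((F.L : ℝ) ^ (j + 1)) * T3UnitScaleTilt.θBal F.L γ b₀ p₀ (K - j) → ∃ h : GaugeTransf (F.P K) j (Matrix.specialUnitaryGroup (Fin 2) ℂ), ∀ c : PBond (F.P K) (j + 1), (c = ⟨a.src, a.μ⟩ ∨ c = ⟨a.src.shift a.μ, a.ν⟩ ∨ c = ⟨a.src.shift a.ν, a.μ⟩ ∨ c = ⟨a.src, a.ν⟩) → ∀ b : PBond (F.P K) j, (blockOf b.src = c.src ∨ blockOf b.src = c.tgt) → (blockOf b.tgt = c.src ∨ blockOf b.tgt = c.tgt) → GaugeGroup.dist1 (Averaging.iter (fun i' => BlockAveraging.blockAvg (P :=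 F.P K) (j := i') T3UnitLawDensityEML.ℰp) j U b * (GaugeField.gaugeAct h (Averaging.iter (fun i' => BlockAveraging.blockAvg (P := F.P K) (j := i') T3UnitLawDensityEML.ℰp) j U') b)⁻¹) ≤ CS / Real.sqrt ((F.L : ℝ) ^ (j + 1)) * Real.sqrt (∑ b : PBond (F.P K) 0, if (∀ k, (b.src k - ((((a.src k).val * F.L ^ (j + 1) : ℕ)) : ZMod ((F.P K).sitesPerDir 0)) + ((8 * F.L ^ (j + 1) : ℕ) : ZMod ((F.P K).sitesPerDir 0))).val < 17 * F.L ^ (j + 1)) ∧ (∀ k, (b.tgt k - ((((a.src k).val * F.L ^ (j + 1) : ℕ)) : ZMod ((F.P K).sitesPerDir 0)) + ((8 * F.L ^ (j + 1) : ℕ) : ZMod ((F.P K).sitesPerDir 0))).val < 17 * F.L ^ (j + 1)) then GaugeGroup.dist1 (U b * (U' b)⁻¹) ^ 2 else 0)) :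
    open Literature.MathematicalPhysics.QuantumFieldTheory.Balaban1983to89 Literature.MathematicalPhysics.QuantumFieldTheory.Balaban1983to89.T3ContinuumYM3Torus in ∀ (L : ℕ), ∃ CL : ℝ, 0 ≤ CL ∧ ∀ (b₀ p₀ : ℝ), 0 < b₀ → 2 < p₀ → ∃ γ₁ : ℝ, 0 < γ₁ ∧ γ₁ ≤ 1 ∧ ∀ (F : T3Family) (γ : ℝ), F.L = L → 0 < γ → γ ≤ γ₁ → ∀ (K j : ℕ), 1 ≤ j → j + 2 ≤ K → 2 ≤ j → ∀ (a : Plaq (F.P K) j) (U U' : GaugeField (F.P K) 0 (Matrix.specialUnitaryGroup (Fin 2) ℂ)), (∀ (i : ℕ) (q : Plaq (F.P K) i), i < j → Site.tdist (fun k => ((((q.src k).val * F.L ^ i : ℕ)) : ZMod ((F.P K).sitesPerDir 0))) (fun k => ((((a.src k).val * F.L ^ j : ℕ)) : ZMod ((F.P K).sitesPerDir 0))) + 64 * F.L ^ i ≤ 64 * F.L ^ j → GaugeGroup.dist1 (GaugeField.plaqHol (Averaging.iter (fun i' => BlockAveraging.blockAvg (P := F.P K) (j := i') T3UnitLawDensityEML.ℰp)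 i U) q) < T3UnitScaleTilt.θBal F.L γ b₀ p₀ (K - i)) → (∀ (i : ℕ) (q : Plaq (F.P K) i), i < j → Site.tdist (fun k => ((((q.src k).val * F.L ^ i : ℕ)) : ZMod ((F.P K).sitesPerDir 0))) (fun k => ((((a.src k).val * F.L ^ j : ℕ)) : ZMod ((F.P K).sitesPerDir 0))) + 64 * F.L ^ i ≤ 64 * F.L ^ j → GaugeGroup.dist1 (GaugeField.plaqHol (Averaging.iter (fun i' => BlockAveraging.blockAvg (P := F.P K) (j := i') T3UnitLawDensityEML.ℰp) i U') q) < T3UnitScaleTilt.θBal F.L γ b₀ p₀ (K - i)) → |GaugeGroup.dist1 (GaugeField.plaqHol (Averaging.iter (fun i' => BlockAveraging.blockAvg (P := F.P K) (j := i') T3UnitLawDensityEML.ℰp) j U) a) - GaugeGroup.dist1 (GaugeField.plaqHol (Averaging.iter (fun i' => BlockAveraging.blockAvg (P := F.P K) (j := i') T3UnitLawDensityEML.ℰp) j U') a)| ≤ CL / Real.sqrt ((F.L : ℝ) ^ j) * Real.sqrt (∑ b : PBond (F.P K) 0, if (∀ k, (b.src k - ((((a.src k).val * F.L ^ j : ℕ))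 : ZMod ((F.P K).sitesPerDir 0)) + ((8 * F.L ^ j : ℕ) : ZMod ((F.P K).sitesPerDir 0))).val < 17 * F.L ^ j) ∧ (∀ k, (b.tgt k - ((((a.src k).val * F.L ^ j : ℕ)) : ZMod ((F.P K).sitesPerDir 0)) + ((8 * F.L ^ j : ℕ) : ZMod ((F.P K).sitesPerDir 0))).val < 17 * F.L ^ j) then GaugeGroup.dist1 (U b * (U' b)⁻¹) ^ 2 else 0) := by
  intro L
  obtain ⟨T, hT, CS, hCS, HS⟩ := hStab L
  refine ⟨max (484 * L * CS) (302 * (L : ℝ) ^ 2 / T), le_max_of_le_left (by positivity), ?_⟩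
  intro b₀ p₀ hb hp
  obtain ⟨γa, hγa, hγa1, HS'⟩ := HS b₀ p₀ hb hp
  obtain ⟨γt, hγt, hγt1, hθσ⟩ := T3Thresholds.exists_gamma_forall_θBal_le (b₀ := b₀) (p₀ := p₀) hb (by linarith)
    (σ := 1 / (75 * ((L : ℝ) + 1) ^ 2)) (by positivity)
  refine ⟨min γa γt, lt_min hγa hγt, (min_le_left _ _).trans hγa1, ?_⟩
  intro F γ hFL hγ hγ1 K j hj1 hjK hj2 a U U' hU hU'
  obtain ⟨j, rfl⟩ : ∃ j', j = j' + 1 := ⟨j - 1, by omega⟩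
  subst hFL
  have hL3 : 3 ≤ F.L := (by obtain ⟨k, hk⟩ := F.hL.1; have := F.hL.2; omega)
  have hγ1' : γ ≤ 1 := hγ1.trans ((min_le_left _ _).trans hγa1)
  have hθσ' : θBal F.L γ b₀ p₀ (K - j) ≤ 1 / (75 * ((F.L : ℝ) + 1) ^ 2) :=
    hθσ F.L (by omega) γ hγ (hγ1.trans (min_le_right _ _)) (K - j)
  have hθpos : 0 < θBal F.L γ b₀ p₀ (K - j) := T3MinimiserStabilityReduction.θBal_pos (by omega) hγ hγ1' hb p₀ (K - j)
  have hsqL : 0 < Real.sqrt ((F.L : ℝ) ^ (j + 1)) := Real.sqrt_pos.mpr (by positivity)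
  set S : ℝ := (∑ b : PBond (F.P K) 0, if (∀ k, (b.src k - ((((a.src k).val * F.L ^ (j + 1) : ℕ)) : ZMod ((F.P K).sitesPerDir 0)) + ((8 * F.L ^ (j + 1) : ℕ) : ZMod ((F.P K).sitesPerDir 0))).val < 17 * F.L ^ (j + 1)) ∧ (∀ k, (b.tgt k - ((((a.src k).val * F.L ^ (j + 1) : ℕ)) : ZMod ((F.P K).sitesPerDir 0)) + ((8 * F.L ^ (j + 1) : ℕ) : ZMod ((F.P K).sitesPerDir 0))).val < 17 * F.L ^ (j + 1)) then GaugeGroup.dist1 (U b * (U' b)⁻¹) ^ 2 else 0) with hS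
  have hS0 : 0 ≤ Real.sqrt S := Real.sqrt_nonneg _
  by_cases hcase : Real.sqrt S ≤ T * Real.sqrt ((F.L : ℝ) ^ (j + 1)) * θBal F.L γ b₀ p₀ (K - j)
  · -- close pair: the restricted row and the K2-TOP step
    obtain ⟨h, hh⟩ := HS' F γ rfl hγ (hγ1.trans (min_le_left _ _)) K j (by omega) (by omega) a U U' hU hU' hcase
    have hρ0 : 0 ≤ CS / Real.sqrt ((F.L : ℝ) ^ (j + 1)) * Real.sqrt S :=
      mul_nonneg (div_nonneg hCS hsqL.le) hS0
    have key := abs_dist1_iter_succ_sub_le_of_gaugeCopy (by omega) hγ hγ1' hb hθσ' a U U' hU hU' h hρ0 hh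
    refine key.trans ?_
    have e : 484 * (F.L : ℝ) * (CS / Real.sqrt ((F.L : ℝ) ^ (j + 1)) * Real.sqrt S) =
        484 * F.L * CS / Real.sqrt ((F.L : ℝ) ^ (j + 1)) * Real.sqrt S := by ring
    rw [e]
    exact mul_le_mul_of_nonneg_right (div_le_div_of_nonneg_right (le_max_left _ _) hsqL.le) hS0
  · -- far pair: both averaged plaquette variables are already `< 151 L² θ`
    have hfar : T * Real.sqrt ((F.L : ℝ) ^ (j + 1)) * θBal F.L γ b₀ p₀ (K - j) < Real.sqrt S := lt_of_not_ge hcase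
    have habs := abs_dist1_iter_succ_sub_lt_of_windows (by omega) hγ hγ1' hb hθσ' a U U' hU hU'
    refine habs.le.trans ?_
    -- `302 L² θ ≤ (302 L²/T) / √(L^{j+1}) · √S` since `T √(L^{j+1}) θ < √S`
    have hθle : θBal F.L γ b₀ p₀ (K - j) ≤ Real.sqrt S / (T * Real.sqrt ((F.L : ℝ) ^ (j + 1))) := by
      rw [le_div_iff₀ (by positivity)]
      linarith
    calc 302 * (F.L : ℝ) ^ 2 * θBal F.L γ b₀ p₀ (K - j)
        ≤ 302 * (F.L : ℝ) ^ 2 * (Real.sqrt S / (T * Real.sqrt ((F.L : ℝ) ^ (j + 1)))) :=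
          mul_le_mul_of_nonneg_left hθle (by positivity)
      _ = 302 * (F.L : ℝ) ^ 2 / T / Real.sqrt ((F.L : ℝ) ^ (j + 1)) * Real.sqrt S := by
          field_simp
      _ ≤ max (484 * (F.L : ℝ) * CS) (302 * (F.L : ℝ) ^ 2 / T) / Real.sqrt ((F.L : ℝ) ^ (j + 1)) * Real.sqrt S :=
          mul_le_mul_of_nonneg_right (div_le_div_of_nonneg_right (le_max_right _ _) hsqL.le) hS0

end Door

end Summit.QuantumFields.YangMills.Theorems.PoincareLipschitzIteratedOfAvgStabilityNear
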